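import Summits.BirchSwinnertonDyer.BirchSwinnertonDyer.Theorems.GoldfeldAllTwistsTwoConverseTwinAdditiveTwoAdicPOne
import HarnessLib

set_option linter.dupNamespace false -- namespace `…BirchSwinnertonDyer.BirchSwinnertonDyer…` is the cell's (D-0017 nested layout)
set_option autoImplicit false

/-!
# Cells C7 and C7A (`q ≡ 7 (8)`, `p ≡ 1 (8)`), file D1-W: the SHARP Selmer set `S(−42qp, 448q²p²) ⊆ {1, 7}` of `W = 49a1^{(−2qp)}` — F9a's
# `S ⊆ {1, 2, 7, 14}` minus the classes `2, 14`, which die at the prime `2` (FACT-FREE; no type condition)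

Cell `bsd-goldfeld`, seat `bsd-goldfeld-s1p-c3x` (gen 13); planner RULING (ccclx), ORDER «C7 −hCT» file 1 of ≤ 3 (also D1 of «OBJECT C7A»; memo
`HOME/C7A-CHIZ-CHANNEL.md` §3). `--supports stmt-BirchSwinnertonDyer-19140` as a HELPER. Theses-free; theorems only; no definition, no fact binder, no `sorry`.
FRONTIER-grade: a twist-density-ZERO sub-family; never distance-to-summit.

WHY. With `#S ≤ 2` (this file) and `#S′ ≤ 4` (F9b on C7, D1-W′ on C7A) the first `2`-descent of `W` is rank-one-SHARP: for `rank W(ℚ) = 1` the images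
already have orders `(2, 4)`, so `Ш(W)[φ] = Ш(W′)[φ̂] = 0` and `Ш(W)[2] = 0` — WITHOUT the Cassels–Tate input `hCT` that F11′/G5 carry on C7 (the kit
column «`S = {1,2,7,14}`» of `C7-HORIZON.md` §3 was a `2`-adic false positive: memo §0).
* `twoIsogenySelmerGroup_twoPrimesTwist_subset_pair_pOne`: `S(−42qp, 448q²p²) ⊆ {1, 7}` for `q ≡ 7 (8)`, `(q/7) = −1`, `p ≡ 1 (8)`, `(−7/p) = 1`,
  `(p/q) = −1` (F9a's `…_subset_pOne` + D0-(L2) `not_isSoluble_two_class_two_even` / `…_fourteen_even` with `u = −qp ≡ 1 (mod 8)`);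
* `card_twoIsogenySelmerGroup_twoPrimesTwist_le_two_pOne`: `#S ≤ 2`.
HONEST FRAMING: a Selmer bound; no `BSD(W,2)` is proved; items 19140 / 20044 unchanged; BSD is not proved by any of this.

References: [SilvermanAEC2009] Prop. X.4.9, Example X.4.10; [Serre1973] Ch. II §3.3 Thm 4.
-/

noncomputable section

open scoped Classical

open WeierstrassCurve Literature.NumberTheory.EllipticCurves

namespace Summit.BirchSwinnertonDyer.BirchSwinnertonDyer.Theorems.GoldfeldGoodTwists

section SelmerWSharp
variable {q p : ℕ} [Fact q.Prime] [Fact p.Prime]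

/-- **`S(−42qp, 448q²p²) ⊆ {1, 7}`** on `q ≡ 7 (8)`, `(q/7) = −1`, `p ≡ 1 (8)`, `(−7/p) = 1`, `(p/q) = −1` (cells C7 and C7A alike).
[cite: SilvermanAEC2009, Prop. X.4.9 and Example X.4.10] -/
theorem twoIsogenySelmerGroup_twoPrimesTwist_subset_pair_pOne (hq8 : q % 8 = 7) (hq7 : jacobiSym q 7 = -1) (hp8 : p % 8 = 1)
    (hp7 : legendreSym p (-7) = 1) (hpq : jacobiSym p q = -1) :
    twoIsogenySelmerGroup (-42 * ((q : ℤ) * p)) (448 * ((q : ℤ) * p) ^ 2) ⊆ ({1, 7} : Finset ℤ) := by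
  have hq : q.Prime := Fact.out
  have hp : p.Prime := Fact.out
  have hq0 : (q : ℤ) ≠ 0 := by exact_mod_cast hq.ne_zero
  have hp0 : (p : ℤ) ≠ 0 := by exact_mod_cast hp.ne_zero
  have hb : (448 * ((q : ℤ) * p) ^ 2 : ℤ) ≠ 0 := mul_ne_zero (by norm_num) (pow_ne_zero 2 (mul_ne_zero hq0 hp0))
  -- `u = −qp ≡ 1 (mod 8)`
  have h8 : (8 : ℤ) ∣ -((q : ℤ) * p) - 1 := by
    have hqp8 : (q * p) % 8 = 7 := by rw [Nat.mul_mod, hq8, hp8]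
    have h8n : (8 : ℤ) ∣ ((q * p : ℕ) : ℤ) + 1 := by omega
    have e : -((q : ℤ) * p) - 1 = -( ((q * p : ℕ) : ℤ) + 1) := by push_cast; ring
    rw [e]; exact (dvd_neg).mpr h8n
  intro d hd
  have hd4 := twoIsogenySelmerGroup_twoPrimesTwist_subset_pOne hq8 hq7 (by omega) hp7 hpq hd
  rw [mem_twoIsogenySelmerGroup_iff hb] at hd
  obtain ⟨-, -, -, hloc⟩ := hd
  simp only [Finset.mem_insert, Finset.mem_singleton] at hd4 ⊢
  rcases hd4 with rfl | rfl | rfl | rfl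
  · exact Or.inl rfl
  · exact absurd (hloc 2) (not_isSoluble_two_class_two_even (u := -((q : ℤ) * p)) h8 (by ring) rfl
      (by rw [show (448 * ((q : ℤ) * p) ^ 2 : ℤ) / 2 = 224 * ((q : ℤ) * p) ^ 2 by omega]; ring))
  · exact Or.inr rfl
  · exact absurd (hloc 2) (not_isSoluble_two_class_fourteen_even (u := -((q : ℤ) * p)) h8 (by ring) rfl
      (by rw [show (448 * ((q : ℤ) * p) ^ 2 : ℤ) / 14 = 32 * ((q : ℤ) * p) ^ 2 by omega]; ring))

/-- **`#S(−42qp, 448q²p²) ≤ 2`** on C7 / C7A (sharp: the image `{1, 7}` of `W(ℚ)/φ̂W′(ℚ)`). [cite: SilvermanAEC2009, Prop. X.4.9 and Example X.4.10] -/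
theorem card_twoIsogenySelmerGroup_twoPrimesTwist_le_two_pOne (hq8 : q % 8 = 7) (hq7 : jacobiSym q 7 = -1) (hp8 : p % 8 = 1)
    (hp7 : legendreSym p (-7) = 1) (hpq : jacobiSym p q = -1) :
    (twoIsogenySelmerGroup (-42 * ((q : ℤ) * p)) (448 * ((q : ℤ) * p) ^ 2)).card ≤ 2 :=
  (Finset.card_le_card (twoIsogenySelmerGroup_twoPrimesTwist_subset_pair_pOne hq8 hq7 hp8 hp7 hpq)).trans Finset.card_le_two

end SelmerWSharp

end Summit.BirchSwinnertonDyer.BirchSwinnertonDyer.Theorems.GoldfeldGoodTwists
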